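import Mathlib
import Literature.NumberTheory.LFunctions.Zhang2022.Section8Lemma84Core
import Literature.NumberTheory.LFunctions.Zhang2022.Section4GaussianWeight
import HarnessLib

/-!
# Zhang (2022) §12 u030: real-variable bookkeeping for the error terms (residues and Landau
# rectangle) of the contour evaluation in the proof of Lemma 12.3

Topic `Literature/NumberTheory/LFunctions/Zhang2022` (Landau–Siegel audit tree; verdict-neutral).
Y. Zhang, *Discrete mean estimates and the Landau–Siegel zero*, arXiv:2211.02515v1 (2022)
[Zhang2022LandauSiegel] — **an unrefereed manuscript under adjudication**; ZHANG-L lane WP12, helper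
under the RT-02 node hTop25Ex (core `Typed.Sec12B.U030`, §12 p.70). Nothing here asserts or denies
Theorems 1–2 of the manuscript.

Pure real-variable inequalities (no `L`-functions): with `𝓛 = log D ≥ 3`, `α = π𝓛⁻⁹`,
`η = c/(8𝓛)`, `Λ = 𝓛¹⁰⁰`, `T′ = D = e^{𝓛}`, `T ≤ Y ≤ P` (`T = e^{𝓛^{1.1}}`, `P = e^{𝓛⁹}`),
`M_U ≤ A₁𝓛^m`, `B_L = 2(4+3𝓛)`, `M_inv = 3C_inv𝓛`, `1 − ρ̃ ≤ K_ρ𝓛⁻²⁰²²`: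

* `resOne_le` — the error of `Lemma84.norm_resOne_sub_model_le` is `≤ C·𝓛⁻¹⁵Π̂²`;
* `resTwo_le` — the error of `Lemma84.norm_resTwo_sub_model_le` is `≤ C·𝓛⁻¹⁵Π̂²`;
* `remainder_le` — the Landau-rectangle remainder of `Lemma84.smoothedSeries_sub_residues_le` is
  `≤ C·𝓛⁻¹⁵` (tails and horizontals are killed by `e^{−D²/(4Λ)}`, the left side by
  `Y^{−3η/4} ≤ e^{−(3c/32)𝓛^{1/10}}` via `Lemma84.pow_mul_exp_neg_tenth_le`),

with constants explicit in `c, C_inv, A₁, m, K, K_ρ, C₈₃`. (Cf. the tree's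
`Lemma84.rhs_le`, `Section8Lemma84Bookkeeping`, for Lemma 8.4.)

## References

* Y. Zhang, arXiv:2211.02515v1 (2022), §12 p.70 (proof of Lemma 12.3), §8 proof of Lemma 8.4 p.47.
  [cite: Zhang2022LandauSiegel, §12 p.70; §8 Lemma 8.4]
-/

noncomputable section

open Real

namespace Literature.NumberTheory.LFunctions.Zhang2022.Lemma84

open Literature.NumberTheory.LFunctions.Zhang2022.GaussWeight

/-- **The first residue's error is `O(𝓛⁻¹⁵Π̂²)`**:
`Π̂²(C₅𝓛⁻¹⁵)(24K²+2K) + 32K³(C𝓛⁻⁸Π̂)(2e^{9/2}(1+𝓛)𝓛)(π𝓛⁻⁹) ≤ (C₅(24K²+2K) + 128πe^{9/2}K³C)𝓛⁻¹⁵Π̂²`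
(`𝓛 ≥ 1`, `Π̂ ≥ 1`, `C, K ≥ 0`). [cite: Zhang2022LandauSiegel, §12 p.70 (proof of Lemma 12.3)] -/
theorem resOne_le {𝓛 hatPi C K C₅ : ℝ} (h𝓛 : 1 ≤ 𝓛) (hPi : 1 ≤ hatPi) (hC : 0 ≤ C) (hK : 0 ≤ K) :
    hatPi ^ 2 * (C₅ / 𝓛 ^ 15) * (24 * K ^ 2 + 2 * K) +
        32 * K ^ 3 * (C * (𝓛 ^ 8)⁻¹ * hatPi) * (2 * Real.exp (9 / 2) * (1 + 𝓛) * 𝓛) * (π / 𝓛 ^ 9) ≤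
      (C₅ * (24 * K ^ 2 + 2 * K) + 128 * π * Real.exp (9 / 2) * K ^ 3 * C) * (𝓛 ^ 15)⁻¹ * hatPi ^ 2 := by
  have h𝓛0 : 0 < 𝓛 := by linarith
  have hPi2 : hatPi ≤ hatPi ^ 2 := by nlinarith
  have h1 : hatPi ^ 2 * (C₅ / 𝓛 ^ 15) * (24 * K ^ 2 + 2 * K) =
      C₅ * (24 * K ^ 2 + 2 * K) * (𝓛 ^ 15)⁻¹ * hatPi ^ 2 := by ring
  have h2 : 32 * K ^ 3 * (C * (𝓛 ^ 8)⁻¹ * hatPi) * (2 * Real.exp (9 / 2) * (1 + 𝓛) * 𝓛) * (π / 𝓛 ^ 9) =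
      64 * π * Real.exp (9 / 2) * K ^ 3 * C * ((1 + 𝓛) * 𝓛 * (𝓛 ^ 8)⁻¹ / 𝓛 ^ 9) * hatPi := by ring
  have h3 : (1 + 𝓛) * 𝓛 * (𝓛 ^ 8)⁻¹ / 𝓛 ^ 9 ≤ 2 * (𝓛 ^ 15)⁻¹ := by
    rw [div_le_iff₀ (by positivity)]
    have e : 2 * (𝓛 ^ 15)⁻¹ * 𝓛 ^ 9 = 2 * 𝓛 ^ 2 * (𝓛 ^ 8)⁻¹ := by field_simp
    rw [e]
    have : (1 + 𝓛) * 𝓛 ≤ 2 * 𝓛 ^ 2 := by nlinarith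
    exact mul_le_mul_of_nonneg_right this (by positivity)
  rw [h1, h2]
  have h4 : 64 * π * Real.exp (9 / 2) * K ^ 3 * C * ((1 + 𝓛) * 𝓛 * (𝓛 ^ 8)⁻¹ / 𝓛 ^ 9) * hatPi ≤
      64 * π * Real.exp (9 / 2) * K ^ 3 * C * (2 * (𝓛 ^ 15)⁻¹) * hatPi ^ 2 := by
    gcongr
  calc _ ≤ C₅ * (24 * K ^ 2 + 2 * K) * (𝓛 ^ 15)⁻¹ * hatPi ^ 2 +
        64 * π * Real.exp (9 / 2) * K ^ 3 * C * (2 * (𝓛 ^ 15)⁻¹) * hatPi ^ 2 := add_le_add le_rfl h4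
    _ = _ := by ring

/-- `𝓛^a · 𝓛⁻ᵇ ≤ 𝓛⁻¹⁵` when `a + 15 ≤ b` (`𝓛 ≥ 1`).
[cite: Zhang2022LandauSiegel, §12 p.70 (proof of Lemma 12.3, bookkeeping)] -/
theorem pow_mul_inv_pow_le {𝓛 : ℝ} (h𝓛 : 1 ≤ 𝓛) {a b : ℕ} (hab : a + 15 ≤ b) :
    𝓛 ^ a * (𝓛 ^ b)⁻¹ ≤ (𝓛 ^ 15)⁻¹ := by
  have h𝓛0 : 0 < 𝓛 := by linarith
  rw [← div_eq_mul_inv, ← one_div, div_le_div_iff₀ (by positivity) (by positivity), one_mul,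
    ← pow_add]
  exact pow_le_pow_right₀ h𝓛 hab


/-- **The second residue's error is `O(𝓛⁻¹⁵Π̂²)`.** With `ℓ₁ = 2e^{9/2}(1+𝓛)𝓛`, `E_U = C𝓛⁻⁸Π̂`,
`E = C₅𝓛⁻¹⁵`, `E′ = 8e^{9/2}(1+𝓛)𝓛²δ`, `α = π𝓛⁻⁹`, `δ = 1 − ρ̃ ≤ K_ρ𝓛⁻²⁰²²`, `log Y ≤ 𝓛⁹`,
`Λ = 𝓛¹⁰⁰`, the bound of `Lemma84.norm_resTwo_sub_model_le` is `≤ C_{res,2}·𝓛⁻¹⁵Π̂²`.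
[cite: Zhang2022LandauSiegel, §12 p.70 (proof of Lemma 12.3)] -/
theorem resTwo_le {𝓛 hatPi C K C₅ Kρ δ logY α Λ : ℝ} (h𝓛 : 1 ≤ 𝓛) (hPi : 1 ≤ hatPi) (hC : 0 ≤ C)
    (hK : 0 ≤ K) (hKρ : 0 ≤ Kρ) (hδ0 : 0 ≤ δ) (hδ : δ ≤ Kρ * (𝓛 ^ 2022)⁻¹)
    (hlogY0 : 0 ≤ logY) (hlogY : logY ≤ 𝓛 ^ 9) (hα : α = π / 𝓛 ^ 9) (hΛ : Λ = 𝓛 ^ 100) :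
    8 * Real.exp π / α *
          (8 * (C * (𝓛 ^ 8)⁻¹ * hatPi) * (2 * Real.exp (9 / 2) * (1 + 𝓛) * 𝓛) * K ^ 2 * α ^ 2 +
            6 * hatPi ^ 2 * K * α * (C₅ / 𝓛 ^ 15) +
            2 * hatPi ^ 2 * K ^ 2 * α ^ 2 * (8 * Real.exp (9 / 2) * (1 + 𝓛) * 𝓛 ^ 2 * δ) +
            4 * hatPi ^ 2 * (2 * Real.exp (9 / 2) * (1 + 𝓛) * 𝓛) * K * α * δ) +
        hatPi ^ 2 * (2 * Real.exp (9 / 2) * (1 + 𝓛) * 𝓛) * K ^ 2 * α ^ 2 *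
          (Real.exp π * ((2 * Real.exp 1 * δ * logY + 1 / (2 * Λ)) * (4 / α) + δ * (8 / α ^ 2))) ≤
      (256 * π * Real.exp π * Real.exp (9 / 2) * C * K ^ 2 + 48 * Real.exp π * K * C₅ +
          256 * π * Real.exp π * Real.exp (9 / 2) * K ^ 2 * Kρ +
          128 * Real.exp π * Real.exp (9 / 2) * K * Kρ +
          32 * π * Real.exp π * Real.exp 1 * Real.exp (9 / 2) * K ^ 2 * Kρ +
          8 * π * Real.exp π * Real.exp (9 / 2) * K ^ 2 +
          32 * Real.exp π * Real.exp (9 / 2) * K ^ 2 * Kρ) * (𝓛 ^ 15)⁻¹ * hatPi ^ 2 := by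
  have h𝓛0 : 0 < 𝓛 := by linarith
  have hα0 : 0 < α := by rw [hα]; positivity
  have hΛ0 : 0 < Λ := by rw [hΛ]; positivity
  have hPi0 : 0 < hatPi := by linarith
  have hPi2 : hatPi ≤ hatPi ^ 2 := by nlinarith
  set ℓ₁ : ℝ := 2 * Real.exp (9 / 2) * (1 + 𝓛) * 𝓛 with hℓ₁
  have hℓ₁le : ℓ₁ ≤ 4 * Real.exp (9 / 2) * 𝓛 ^ 2 := by
    rw [hℓ₁]
    have h1 : (1 + 𝓛) * 𝓛 ≤ 2 * 𝓛 ^ 2 := by nlinarith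
    calc 2 * Real.exp (9 / 2) * (1 + 𝓛) * 𝓛 = 2 * Real.exp (9 / 2) * ((1 + 𝓛) * 𝓛) := by ring
      _ ≤ 2 * Real.exp (9 / 2) * (2 * 𝓛 ^ 2) := by gcongr
      _ = 4 * Real.exp (9 / 2) * 𝓛 ^ 2 := by ring
  have hℓ₁0 : 0 ≤ ℓ₁ := by rw [hℓ₁]; positivity
  set W : ℝ := (𝓛 ^ 15)⁻¹ * hatPi ^ 2 with hW
  have hW0 : 0 ≤ W := by positivity
  have hE'le : 8 * Real.exp (9 / 2) * (1 + 𝓛) * 𝓛 ^ 2 * δ ≤ 16 * Real.exp (9 / 2) * 𝓛 ^ 3 * δ := by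
    have h1 : (1 + 𝓛) * 𝓛 ^ 2 ≤ 2 * 𝓛 ^ 3 := by nlinarith [pow_pos h𝓛0 2]
    calc 8 * Real.exp (9 / 2) * (1 + 𝓛) * 𝓛 ^ 2 * δ = 8 * Real.exp (9 / 2) * ((1 + 𝓛) * 𝓛 ^ 2) * δ := by
          ring
      _ ≤ 8 * Real.exp (9 / 2) * (2 * 𝓛 ^ 3) * δ := by gcongr
      _ = 16 * Real.exp (9 / 2) * 𝓛 ^ 3 * δ := by ring
  -- expand into seven terms
  have hexpand : 8 * Real.exp π / α *
          (8 * (C * (𝓛 ^ 8)⁻¹ * hatPi) * ℓ₁ * K ^ 2 * α ^ 2 + 6 * hatPi ^ 2 * K * α * (C₅ / 𝓛 ^ 15) +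
            2 * hatPi ^ 2 * K ^ 2 * α ^ 2 * (8 * Real.exp (9 / 2) * (1 + 𝓛) * 𝓛 ^ 2 * δ) +
            4 * hatPi ^ 2 * ℓ₁ * K * α * δ) +
        hatPi ^ 2 * ℓ₁ * K ^ 2 * α ^ 2 *
          (Real.exp π * ((2 * Real.exp 1 * δ * logY + 1 / (2 * Λ)) * (4 / α) + δ * (8 / α ^ 2))) =
      64 * Real.exp π * C * (𝓛 ^ 8)⁻¹ * hatPi * ℓ₁ * K ^ 2 * α +
        48 * Real.exp π * hatPi ^ 2 * K * (C₅ / 𝓛 ^ 15) +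
        16 * Real.exp π * hatPi ^ 2 * K ^ 2 * α * (8 * Real.exp (9 / 2) * (1 + 𝓛) * 𝓛 ^ 2 * δ) +
        32 * Real.exp π * hatPi ^ 2 * ℓ₁ * K * δ +
        8 * Real.exp 1 * Real.exp π * hatPi ^ 2 * ℓ₁ * K ^ 2 * α * δ * logY +
        2 * Real.exp π * hatPi ^ 2 * ℓ₁ * K ^ 2 * α / Λ +
        8 * Real.exp π * hatPi ^ 2 * ℓ₁ * K ^ 2 * δ := by
    field_simp
    ring
  rw [hexpand]
  -- powers of `𝓛`
  have hp1 : 𝓛 ^ 2 * (𝓛 ^ 8)⁻¹ * (π / 𝓛 ^ 9) = π * (𝓛 ^ 2 * (𝓛 ^ 17)⁻¹) := by field_simp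
  have hq1 : 𝓛 ^ 2 * (𝓛 ^ 17)⁻¹ ≤ (𝓛 ^ 15)⁻¹ := pow_mul_inv_pow_le h𝓛 (by norm_num)
  have hq3 : 𝓛 ^ 3 * (𝓛 ^ 2031)⁻¹ ≤ (𝓛 ^ 15)⁻¹ := pow_mul_inv_pow_le h𝓛 (by norm_num)
  have hq4 : 𝓛 ^ 2 * (𝓛 ^ 2022)⁻¹ ≤ (𝓛 ^ 15)⁻¹ := pow_mul_inv_pow_le h𝓛 (by norm_num)
  have hq6 : 𝓛 ^ 2 * (𝓛 ^ 109)⁻¹ ≤ (𝓛 ^ 15)⁻¹ := pow_mul_inv_pow_le h𝓛 (by norm_num)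
  -- T1
  have hT1 : 64 * Real.exp π * C * (𝓛 ^ 8)⁻¹ * hatPi * ℓ₁ * K ^ 2 * α ≤
      256 * π * Real.exp π * Real.exp (9 / 2) * C * K ^ 2 * W := by
    calc 64 * Real.exp π * C * (𝓛 ^ 8)⁻¹ * hatPi * ℓ₁ * K ^ 2 * α
        ≤ 64 * Real.exp π * C * (𝓛 ^ 8)⁻¹ * hatPi ^ 2 * (4 * Real.exp (9 / 2) * 𝓛 ^ 2) * K ^ 2 *
            (π / 𝓛 ^ 9) := by rw [hα]; gcongr
      _ = 256 * π * Real.exp π * Real.exp (9 / 2) * C * K ^ 2 *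
            ((𝓛 ^ 2 * (𝓛 ^ 17)⁻¹) * hatPi ^ 2) := by field_simp; ring
      _ ≤ 256 * π * Real.exp π * Real.exp (9 / 2) * C * K ^ 2 * ((𝓛 ^ 15)⁻¹ * hatPi ^ 2) := by
          gcongr
  -- T2
  have hT2 : 48 * Real.exp π * hatPi ^ 2 * K * (C₅ / 𝓛 ^ 15) = 48 * Real.exp π * K * C₅ * W := by
    rw [hW]; field_simp
  -- T3
  have hT3 : 16 * Real.exp π * hatPi ^ 2 * K ^ 2 * α * (8 * Real.exp (9 / 2) * (1 + 𝓛) * 𝓛 ^ 2 * δ) ≤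
      256 * π * Real.exp π * Real.exp (9 / 2) * K ^ 2 * Kρ * W := by
    calc 16 * Real.exp π * hatPi ^ 2 * K ^ 2 * α * (8 * Real.exp (9 / 2) * (1 + 𝓛) * 𝓛 ^ 2 * δ)
        ≤ 16 * Real.exp π * hatPi ^ 2 * K ^ 2 * α * (16 * Real.exp (9 / 2) * 𝓛 ^ 3 * δ) := by
          gcongr
      _ ≤ 16 * Real.exp π * hatPi ^ 2 * K ^ 2 * α *
            (16 * Real.exp (9 / 2) * 𝓛 ^ 3 * (Kρ * (𝓛 ^ 2022)⁻¹)) := by gcongr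
      _ = 256 * π * Real.exp π * Real.exp (9 / 2) * K ^ 2 * Kρ *
            ((𝓛 ^ 3 * (𝓛 ^ 2031)⁻¹) * hatPi ^ 2) := by rw [hα]; field_simp; ring
      _ ≤ 256 * π * Real.exp π * Real.exp (9 / 2) * K ^ 2 * Kρ * ((𝓛 ^ 15)⁻¹ * hatPi ^ 2) := by
          gcongr
  -- T4
  have hT4 : 32 * Real.exp π * hatPi ^ 2 * ℓ₁ * K * δ ≤
      128 * Real.exp π * Real.exp (9 / 2) * K * Kρ * W := by
    calc 32 * Real.exp π * hatPi ^ 2 * ℓ₁ * K * δ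
        ≤ 32 * Real.exp π * hatPi ^ 2 * (4 * Real.exp (9 / 2) * 𝓛 ^ 2) * K * (Kρ * (𝓛 ^ 2022)⁻¹) := by
          gcongr
      _ = 128 * Real.exp π * Real.exp (9 / 2) * K * Kρ * ((𝓛 ^ 2 * (𝓛 ^ 2022)⁻¹) * hatPi ^ 2) := by
          ring
      _ ≤ 128 * Real.exp π * Real.exp (9 / 2) * K * Kρ * ((𝓛 ^ 15)⁻¹ * hatPi ^ 2) := by gcongr
  -- T5
  have hT5 : 8 * Real.exp 1 * Real.exp π * hatPi ^ 2 * ℓ₁ * K ^ 2 * α * δ * logY ≤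
      32 * π * Real.exp π * Real.exp 1 * Real.exp (9 / 2) * K ^ 2 * Kρ * W := by
    calc 8 * Real.exp 1 * Real.exp π * hatPi ^ 2 * ℓ₁ * K ^ 2 * α * δ * logY
        ≤ 8 * Real.exp 1 * Real.exp π * hatPi ^ 2 * (4 * Real.exp (9 / 2) * 𝓛 ^ 2) * K ^ 2 *
            (π / 𝓛 ^ 9) * (Kρ * (𝓛 ^ 2022)⁻¹) * 𝓛 ^ 9 := by rw [hα]; gcongr
      _ = 32 * π * Real.exp π * Real.exp 1 * Real.exp (9 / 2) * K ^ 2 * Kρ *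
            ((𝓛 ^ 2 * (𝓛 ^ 2022)⁻¹) * hatPi ^ 2) := by field_simp; ring
      _ ≤ 32 * π * Real.exp π * Real.exp 1 * Real.exp (9 / 2) * K ^ 2 * Kρ *
            ((𝓛 ^ 15)⁻¹ * hatPi ^ 2) := by gcongr
  -- T6
  have hT6 : 2 * Real.exp π * hatPi ^ 2 * ℓ₁ * K ^ 2 * α / Λ ≤
      8 * π * Real.exp π * Real.exp (9 / 2) * K ^ 2 * W := by
    rw [hΛ]
    calc 2 * Real.exp π * hatPi ^ 2 * ℓ₁ * K ^ 2 * α / 𝓛 ^ 100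
        ≤ 2 * Real.exp π * hatPi ^ 2 * (4 * Real.exp (9 / 2) * 𝓛 ^ 2) * K ^ 2 * (π / 𝓛 ^ 9) /
            𝓛 ^ 100 := by rw [hα]; gcongr
      _ = 8 * π * Real.exp π * Real.exp (9 / 2) * K ^ 2 * ((𝓛 ^ 2 * (𝓛 ^ 109)⁻¹) * hatPi ^ 2) := by
          field_simp; ring
      _ ≤ 8 * π * Real.exp π * Real.exp (9 / 2) * K ^ 2 * ((𝓛 ^ 15)⁻¹ * hatPi ^ 2) := by gcongr
  -- T7
  have hT7 : 8 * Real.exp π * hatPi ^ 2 * ℓ₁ * K ^ 2 * δ ≤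
      32 * Real.exp π * Real.exp (9 / 2) * K ^ 2 * Kρ * W := by
    calc 8 * Real.exp π * hatPi ^ 2 * ℓ₁ * K ^ 2 * δ
        ≤ 8 * Real.exp π * hatPi ^ 2 * (4 * Real.exp (9 / 2) * 𝓛 ^ 2) * K ^ 2 *
            (Kρ * (𝓛 ^ 2022)⁻¹) := by gcongr
      _ = 32 * Real.exp π * Real.exp (9 / 2) * K ^ 2 * Kρ * ((𝓛 ^ 2 * (𝓛 ^ 2022)⁻¹) * hatPi ^ 2) := by
          ring
      _ ≤ 32 * Real.exp π * Real.exp (9 / 2) * K ^ 2 * Kρ * ((𝓛 ^ 15)⁻¹ * hatPi ^ 2) := by gcongr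
  rw [hT2]
  have hsum := add_le_add (add_le_add (add_le_add (add_le_add (add_le_add (add_le_add hT1
    (le_refl (48 * Real.exp π * K * C₅ * W))) hT3) hT4) hT5) hT6) hT7
  refine hsum.trans (le_of_eq ?_)
  rw [hW]; ring

/-- `16𝓛¹⁰⁹ ≤ e^{2𝓛}` once `𝓛 ≥ 16·110!/2¹¹⁰` (from `𝓛¹¹⁰e^{−2𝓛} ≤ 110!/2¹¹⁰`).
[cite: Zhang2022LandauSiegel, §12 p.70 (proof of Lemma 12.3, bookkeeping)] -/
theorem sixteen_pow_le_exp {𝓛 : ℝ} (h𝓛 : 1 ≤ 𝓛)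
    (hbig : 16 * (Nat.factorial 110 : ℝ) / 2 ^ 110 ≤ 𝓛) : 16 * 𝓛 ^ 109 ≤ Real.exp (2 * 𝓛) := by
  have h𝓛0 : 0 < 𝓛 := lt_of_lt_of_le one_pos h𝓛
  have h := pow_mul_exp_neg_le (a := 2) (by norm_num) h𝓛0.le 110
  -- `𝓛¹¹⁰ ≤ (110!/2¹¹⁰) e^{2𝓛}`
  have h1 : 𝓛 ^ 110 ≤ (Nat.factorial 110 : ℝ) / 2 ^ 110 * Real.exp (2 * 𝓛) := by
    have e : 𝓛 ^ 110 = 𝓛 ^ 110 * Real.exp (-(2 * 𝓛)) * Real.exp (2 * 𝓛) := by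
      rw [mul_assoc, ← Real.exp_add, neg_add_cancel, Real.exp_zero, mul_one]
    rw [e]
    exact mul_le_mul_of_nonneg_right h (Real.exp_pos _).le
  -- `16𝓛¹⁰⁹ · 𝓛 ≤ 16 (110!/2¹¹⁰) e^{2𝓛} ≤ 𝓛 e^{2𝓛}`
  have h2 : 16 * 𝓛 ^ 109 * 𝓛 ≤ Real.exp (2 * 𝓛) * 𝓛 := by
    calc 16 * 𝓛 ^ 109 * 𝓛 = 16 * 𝓛 ^ 110 := by ring
      _ ≤ 16 * ((Nat.factorial 110 : ℝ) / 2 ^ 110 * Real.exp (2 * 𝓛)) := by gcongr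
      _ = (16 * (Nat.factorial 110 : ℝ) / 2 ^ 110) * Real.exp (2 * 𝓛) := by ring
      _ ≤ 𝓛 * Real.exp (2 * 𝓛) := mul_le_mul_of_nonneg_right hbig (Real.exp_pos _).le
      _ = Real.exp (2 * 𝓛) * 𝓛 := mul_comm _ _
  exact le_of_mul_le_mul_right h2 h𝓛0

/-- The Gaussian factor at height `T′ = D = e^{𝓛}` with `Λ = 𝓛¹⁰⁰`:
`e^{−D²/(4Λ)} ≤ e^{−2𝓛⁹}·e^{−2𝓛}` (for `16𝓛¹⁰⁹ ≤ e^{2𝓛}`).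
[cite: Zhang2022LandauSiegel, §12 p.70 (proof of Lemma 12.3, bookkeeping)] -/
theorem gauss_height_le {𝓛 : ℝ} (h𝓛 : 1 ≤ 𝓛) (hbig : 16 * (Nat.factorial 110 : ℝ) / 2 ^ 110 ≤ 𝓛) :
    gauss (4 * 𝓛 ^ 100)⁻¹ (Real.exp 𝓛) ≤ Real.exp (-(2 * 𝓛 ^ 9)) * Real.exp (-(2 * 𝓛)) := by
  have h𝓛0 : 0 < 𝓛 := by linarith
  have h16 := sixteen_pow_le_exp h𝓛 hbig
  rw [gauss, ← Real.exp_add, Real.exp_le_exp]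
  have e2 : Real.exp 𝓛 ^ 2 = Real.exp (2 * 𝓛) := by rw [← Real.exp_nat_mul]; norm_num
  rw [e2]
  -- `(4𝓛¹⁰⁰)⁻¹ e^{2𝓛} ≥ 4𝓛⁹ ≥ 2𝓛⁹ + 2𝓛`
  have h1 : 4 * 𝓛 ^ 9 ≤ (4 * 𝓛 ^ 100)⁻¹ * Real.exp (2 * 𝓛) := by
    rw [le_inv_mul_iff₀ (by positivity)]
    calc 4 * 𝓛 ^ 100 * (4 * 𝓛 ^ 9) = 16 * 𝓛 ^ 109 := by ring
      _ ≤ Real.exp (2 * 𝓛) := h16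
  have h2 : 𝓛 ≤ 𝓛 ^ 9 := le_self_pow₀ h𝓛 (by norm_num)
  linarith

/-- `√(4πΛ) ≤ 4πΛ` for `Λ ≥ 1`. [cite: Zhang2022LandauSiegel, §12 p.70 (bookkeeping)] -/
theorem sqrt_four_pi_mul_le {Λ : ℝ} (hΛ : 1 ≤ Λ) : Real.sqrt (4 * π * Λ) ≤ 4 * π * Λ := by
  have h1 : 1 ≤ 4 * π * Λ := by nlinarith [Real.pi_gt_three]
  rw [Real.sqrt_le_iff]
  exact ⟨by linarith, by nlinarith⟩

set_option maxHeartbeats 800000 in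
/-- **Tails piece**: `2·27M_U·(Y^{1+θ}e^{(1+θ)²/4Λ}/|1+θ|)·(e^{−D²/4Λ}√(4πΛ)/2) ≤ 648πA₁(m+115)!/2^{m+115}·𝓛⁻¹⁵`.
[cite: Zhang2022LandauSiegel, §12 p.70 (proof of Lemma 12.3)] [cite: MontgomeryVaughan2007, §6.2] -/
theorem tails_piece_le {𝓛 A₁ MU Y θ : ℝ} {m : ℕ} (h𝓛 : 3 ≤ 𝓛) (hA₁ : 0 ≤ A₁)
    (hMU : MU ≤ A₁ * 𝓛 ^ m) (hY1 : 1 ≤ Y) (hY2 : Y ≤ Real.exp (𝓛 ^ 9)) (hθ : |θ| ≤ 1 / 2)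
    (hbig : 16 * (Nat.factorial 110 : ℝ) / 2 ^ 110 ≤ 𝓛) :
    2 * ((MU * ((1 + 1 / 2) / (1 / 2)) ^ 3) *
          (Y ^ (1 + θ) * rexp ((1 + θ) ^ 2 / (4 * 𝓛 ^ 100)) / |1 + θ|) *
        (gauss (4 * 𝓛 ^ 100)⁻¹ (Real.exp 𝓛) * (Real.sqrt (4 * π * 𝓛 ^ 100) / 2))) ≤
      648 * π * A₁ * ((m + 115).factorial / 2 ^ (m + 115)) * (𝓛 ^ 15)⁻¹ := by
  have h𝓛0 : 0 < 𝓛 := by linarith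
  have h𝓛1 : 1 ≤ 𝓛 := by linarith
  have hπ0 := Real.pi_pos
  have hθb := abs_le.mp hθ
  have hΛ1 : (1 : ℝ) ≤ 𝓛 ^ 100 := one_le_pow₀ h𝓛1
  have hY0 : 0 < Y := by linarith
  have hYpos : Y ^ (1 + θ) ≤ Real.exp (2 * 𝓛 ^ 9) := by
    calc Y ^ (1 + θ) ≤ Y ^ (2 : ℝ) := Real.rpow_le_rpow_of_exponent_le hY1 (by linarith)
      _ = Y ^ 2 := Real.rpow_two Y
      _ ≤ Real.exp (𝓛 ^ 9) ^ 2 := pow_le_pow_left₀ hY0.le hY2 2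
      _ = Real.exp (2 * 𝓛 ^ 9) := by rw [← Real.exp_nat_mul]; norm_num
  have hgauss := gauss_height_le h𝓛1 hbig
  have hsqrt : Real.sqrt (4 * π * 𝓛 ^ 100) ≤ 4 * π * 𝓛 ^ 100 := sqrt_four_pi_mul_le hΛ1
  have he3 : Real.exp 1 ≤ 3 := by have := Real.exp_one_lt_d9; linarith
  have hE1 : rexp ((1 + θ) ^ 2 / (4 * 𝓛 ^ 100)) ≤ 3 := by
    refine le_trans (Real.exp_le_exp.mpr ?_) he3
    rw [div_le_one (by positivity)]; nlinarith
  have hfrac : Y ^ (1 + θ) * rexp ((1 + θ) ^ 2 / (4 * 𝓛 ^ 100)) / |1 + θ| ≤ Real.exp (2 * 𝓛 ^ 9) * 6 := by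
    have habs : 1 / 2 ≤ |1 + θ| := by rw [abs_of_pos (by linarith)]; linarith
    have habs0 : 0 < |1 + θ| := by linarith
    rw [div_le_iff₀ habs0]
    calc Y ^ (1 + θ) * rexp ((1 + θ) ^ 2 / (4 * 𝓛 ^ 100)) ≤ Real.exp (2 * 𝓛 ^ 9) * 3 := by gcongr
      _ = Real.exp (2 * 𝓛 ^ 9) * 6 * (1 / 2) := by ring
      _ ≤ Real.exp (2 * 𝓛 ^ 9) * 6 * |1 + θ| := by gcongr
  have hn : ((1 + 1 / 2) / (1 / 2) : ℝ) ^ 3 = 27 := by norm_num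
  rw [hn]
  have hdec : 𝓛 ^ (m + 115) * Real.exp (-(2 * 𝓛)) ≤ ((m + 115).factorial : ℝ) / 2 ^ (m + 115) :=
    pow_mul_exp_neg_le (a := 2) (by norm_num) h𝓛0.le (m + 115)
  have hkey : 𝓛 ^ m * 𝓛 ^ 100 = 𝓛 ^ (m + 115) * (𝓛 ^ 15)⁻¹ := by
    rw [pow_add, mul_assoc, show (115 : ℕ) = 100 + 15 by norm_num, pow_add, mul_assoc,
      mul_inv_cancel₀ (by positivity), mul_one]
  have hEE : Real.exp (2 * 𝓛 ^ 9) * Real.exp (-(2 * 𝓛 ^ 9)) = 1 := by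
    rw [← Real.exp_add, add_neg_cancel, Real.exp_zero]
  calc 2 * ((MU * 27) * (Y ^ (1 + θ) * rexp ((1 + θ) ^ 2 / (4 * 𝓛 ^ 100)) / |1 + θ|) *
        (gauss (4 * 𝓛 ^ 100)⁻¹ (Real.exp 𝓛) * (Real.sqrt (4 * π * 𝓛 ^ 100) / 2)))
      ≤ 2 * ((A₁ * 𝓛 ^ m * 27) * (Real.exp (2 * 𝓛 ^ 9) * 6) *
        ((Real.exp (-(2 * 𝓛 ^ 9)) * Real.exp (-(2 * 𝓛))) * (4 * π * 𝓛 ^ 100 / 2))) := by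
        have hg0 : 0 ≤ gauss (4 * 𝓛 ^ 100)⁻¹ (Real.exp 𝓛) * (Real.sqrt (4 * π * 𝓛 ^ 100) / 2) :=
          mul_nonneg (gauss_pos _ _).le (by positivity)
        have h1 : gauss (4 * 𝓛 ^ 100)⁻¹ (Real.exp 𝓛) * (Real.sqrt (4 * π * 𝓛 ^ 100) / 2) ≤
            (Real.exp (-(2 * 𝓛 ^ 9)) * Real.exp (-(2 * 𝓛))) * (4 * π * 𝓛 ^ 100 / 2) :=
          mul_le_mul hgauss (by linarith) (by positivity) (by positivity)
        have hfrac0 : 0 ≤ Y ^ (1 + θ) * rexp ((1 + θ) ^ 2 / (4 * 𝓛 ^ 100)) / |1 + θ| := by positivity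
        have h2 : MU * 27 ≤ A₁ * 𝓛 ^ m * 27 := by gcongr
        have h3 := mul_le_mul (mul_le_mul h2 hfrac hfrac0 (by positivity)) h1 hg0 (by positivity)
        linarith
    _ = 648 * π * A₁ * (Real.exp (2 * 𝓛 ^ 9) * Real.exp (-(2 * 𝓛 ^ 9))) * Real.exp (-(2 * 𝓛)) *
        (𝓛 ^ m * 𝓛 ^ 100) := by ring
    _ = 648 * π * A₁ * ((𝓛 ^ (m + 115) * Real.exp (-(2 * 𝓛))) * (𝓛 ^ 15)⁻¹) := by
        rw [hEE, hkey]; ring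
    _ ≤ 648 * π * A₁ * ((((m + 115).factorial : ℝ) / 2 ^ (m + 115)) * (𝓛 ^ 15)⁻¹) := by gcongr
    _ = _ := by ring

set_option maxHeartbeats 800000 in
/-- **Left-side piece**: `M_UB_L²M_inv(1+2/η)·(Y^{−η+θ}e^{(θ−η)²/4Λ}/|θ−η|)·√(4πΛ) ≤
652800πA₁C_inv c⁻²·(10(m+120))!/(3c/32)^{10(m+120)}·𝓛⁻¹⁵`.
[cite: Zhang2022LandauSiegel, §12 p.70 (proof of Lemma 12.3)] [cite: MontgomeryVaughan2007, §6.2] -/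
theorem left_piece_le {𝓛 c Cinv A₁ MU Y θ : ℝ} {m : ℕ} (h𝓛 : 3 ≤ 𝓛) (hc : 0 < c) (hc1 : c ≤ 1 / 4)
    (hCinv : 0 ≤ Cinv) (hA₁ : 0 ≤ A₁) (hMU : MU ≤ A₁ * 𝓛 ^ m)
    (hY1 : Real.exp (𝓛 ^ (1.1 : ℝ)) ≤ Y) (hθ : |θ| ≤ c / (8 * 𝓛) / 4) :
    (MU * (2 * (4 + 3 * 𝓛)) * (2 * (4 + 3 * 𝓛)) * (3 * Cinv * 𝓛 * (1 + 2 / (c / (8 * 𝓛))))) *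
        (Y ^ (-(c / (8 * 𝓛)) + θ) * rexp ((-(c / (8 * 𝓛)) + θ) ^ 2 / (4 * 𝓛 ^ 100)) /
          |(-(c / (8 * 𝓛))) + θ|) * Real.sqrt (4 * π * 𝓛 ^ 100) ≤
      652800 * π * A₁ * Cinv / c ^ 2 * ((10 * (m + 120)).factorial / (3 * c / 32) ^ (10 * (m + 120))) *
        (𝓛 ^ 15)⁻¹ := by
  set Fbig : ℝ := ((10 * (m + 120)).factorial : ℝ) / (3 * c / 32) ^ (10 * (m + 120)) with hFbig
  set Fr : ℝ := Y ^ (-(c / (8 * 𝓛)) + θ) * rexp ((-(c / (8 * 𝓛)) + θ) ^ 2 / (4 * 𝓛 ^ 100)) /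
    |(-(c / (8 * 𝓛))) + θ| with hFr
  set Pr : ℝ := MU * (2 * (4 + 3 * 𝓛)) * (2 * (4 + 3 * 𝓛)) * (3 * Cinv * 𝓛 * (1 + 2 / (c / (8 * 𝓛))))
    with hPr
  set Sr : ℝ := Real.sqrt (4 * π * 𝓛 ^ 100) with hSr
  have h𝓛0 : 0 < 𝓛 := by linarith
  have h𝓛1 : 1 ≤ 𝓛 := by linarith
  have hπ0 := Real.pi_pos
  set η : ℝ := c / (8 * 𝓛) with hη
  have hη0 : 0 < η := by positivity
  have hη' : η ≤ 1 / 96 := by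
    calc η = c / (8 * 𝓛) := hη
      _ ≤ (1 / 4) / (8 * 3) := by gcongr
      _ = 1 / 96 := by norm_num
  have hθb := abs_le.mp hθ
  have hΛ1 : (1 : ℝ) ≤ 𝓛 ^ 100 := one_le_pow₀ h𝓛1
  have hY0 : 0 < Y := lt_of_lt_of_le (Real.exp_pos _) hY1
  -- the decay `Y^{−η+θ} ≤ e^{−(3c/32)𝓛^{1/10}}`
  have hpow : 𝓛 ^ (1.1 : ℝ) = 𝓛 ^ (1 / 10 : ℝ) * 𝓛 := by
    rw [← Real.rpow_add_one h𝓛0.ne']; norm_num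
  set Ed : ℝ := Real.exp (-(3 * c / 32 * 𝓛 ^ (1 / 10 : ℝ))) with hEd
  have hYneg : Y ^ (-η + θ) ≤ Ed := by
    have h1 : Y ^ (-η + θ) ≤ Real.exp (𝓛 ^ (1.1 : ℝ)) ^ (-η + θ) :=
      Real.rpow_le_rpow_of_nonpos (Real.exp_pos _) hY1 (by linarith)
    refine h1.trans ?_
    rw [hEd, ← Real.exp_mul, Real.exp_le_exp]
    have h2 : 𝓛 ^ (1.1 : ℝ) * (-η + θ) ≤ 𝓛 ^ (1.1 : ℝ) * (-(3 * η / 4)) :=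
      mul_le_mul_of_nonneg_left (by linarith) (Real.rpow_nonneg h𝓛0.le _)
    have h3 : 𝓛 ^ (1.1 : ℝ) * (-(3 * η / 4)) = -(3 * c / 32 * 𝓛 ^ (1 / 10 : ℝ)) := by
      rw [hpow, hη]; field_simp; ring
    linarith
  have hsqrt : Sr ≤ 4 * π * 𝓛 ^ 100 := sqrt_four_pi_mul_le hΛ1
  have he3 : Real.exp 1 ≤ 3 := by have := Real.exp_one_lt_d9; linarith
  have hE2 : rexp ((-η + θ) ^ 2 / (4 * 𝓛 ^ 100)) ≤ 3 := by
    refine le_trans (Real.exp_le_exp.mpr ?_) he3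
    rw [div_le_one (by positivity)]; nlinarith
  have hBL : 2 * (4 + 3 * 𝓛) ≤ 10 * 𝓛 := by linarith
  have hBL0 : 0 ≤ 2 * (4 + 3 * 𝓛) := by linarith
  have h2η : 1 + 2 / η ≤ 17 * 𝓛 / c := by
    rw [hη, div_div_eq_mul_div, show 1 + 2 * (8 * 𝓛) / c = (c + 16 * 𝓛) / c by field_simp; ring]
    gcongr
    linarith
  -- the fraction
  have hFrle : Fr ≤ Ed * 3 * (32 * 𝓛 / (3 * c)) := by
    have habs : 3 * η / 4 ≤ |(-η) + θ| := by
      rw [abs_of_neg (by linarith)]; linarith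
    have habs0 : 0 < |(-η) + θ| := by linarith
    have hη4 : (32 * 𝓛 / (3 * c)) * (3 * η / 4) = 1 := by rw [hη]; field_simp; ring
    rw [hFr, div_le_iff₀ habs0]
    calc Y ^ (-η + θ) * rexp ((-η + θ) ^ 2 / (4 * 𝓛 ^ 100)) ≤ Ed * 3 :=
          mul_le_mul hYneg hE2 (Real.exp_pos _).le (Real.exp_pos _).le
      _ = Ed * 3 * ((32 * 𝓛 / (3 * c)) * (3 * η / 4)) := by rw [hη4, mul_one]
      _ = Ed * 3 * (32 * 𝓛 / (3 * c)) * (3 * η / 4) := by ring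
      _ ≤ Ed * 3 * (32 * 𝓛 / (3 * c)) * |(-η) + θ| :=
          mul_le_mul_of_nonneg_left habs (by positivity)
  have hFr0 : 0 ≤ Fr := by
    rw [hFr]
    exact div_nonneg (mul_nonneg (Real.rpow_nonneg hY0.le _) (Real.exp_pos _).le) (abs_nonneg _)
  -- the polynomial factor
  have hA𝓛 : 0 ≤ A₁ * 𝓛 ^ m := mul_nonneg hA₁ (pow_nonneg h𝓛0.le m)
  have h10 : (0 : ℝ) ≤ 10 * 𝓛 := by linarith
  have h17 : 0 ≤ 3 * Cinv * 𝓛 * (17 * 𝓛 / c) :=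
    mul_nonneg (mul_nonneg (mul_nonneg (by norm_num) hCinv) h𝓛0.le) (div_nonneg (by linarith) hc.le)
  have hPrle : Pr ≤ (A₁ * 𝓛 ^ m) * (10 * 𝓛) * (10 * 𝓛) * (3 * Cinv * 𝓛 * (17 * 𝓛 / c)) := by
    rw [hPr]
    have h3C : 0 ≤ 3 * Cinv * 𝓛 := mul_nonneg (mul_nonneg (by norm_num) hCinv) h𝓛0.le
    have hin : 3 * Cinv * 𝓛 * (1 + 2 / η) ≤ 3 * Cinv * 𝓛 * (17 * 𝓛 / c) :=
      mul_le_mul_of_nonneg_left h2η h3C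
    have hin0 : 0 ≤ 3 * Cinv * 𝓛 * (1 + 2 / η) := mul_nonneg h3C (by positivity)
    exact mul_le_mul (mul_le_mul (mul_le_mul hMU hBL hBL0 hA𝓛) hBL hBL0 (mul_nonneg hA𝓛 h10))
      hin hin0 (mul_nonneg (mul_nonneg hA𝓛 h10) h10)
  have hP'0 : 0 ≤ (A₁ * 𝓛 ^ m) * (10 * 𝓛) * (10 * 𝓛) * (3 * Cinv * 𝓛 * (17 * 𝓛 / c)) :=
    mul_nonneg (mul_nonneg (mul_nonneg hA𝓛 h10) h10) h17
  have hF'0 : 0 ≤ Ed * 3 * (32 * 𝓛 / (3 * c)) :=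
    mul_nonneg (mul_nonneg (Real.exp_pos _).le (by norm_num))
      (div_nonneg (by linarith) (by linarith))
  have hmain : Pr * Fr * Sr ≤ ((A₁ * 𝓛 ^ m) * (10 * 𝓛) * (10 * 𝓛) * (3 * Cinv * 𝓛 * (17 * 𝓛 / c))) *
      (Ed * 3 * (32 * 𝓛 / (3 * c))) * (4 * π * 𝓛 ^ 100) :=
    mul_le_mul (mul_le_mul hPrle hFrle hFr0 hP'0) hsqrt (Real.sqrt_nonneg _) (mul_nonneg hP'0 hF'0)
  -- the decay estimate
  have hdec : 𝓛 ^ (m + 120) * Ed ≤ Fbig := by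
    rw [hEd, hFbig]
    exact pow_mul_exp_neg_tenth_le (a := 3 * c / 32) (by positivity) h𝓛0.le (m + 120)
  clear_value Fbig
  have hkey : 𝓛 ^ m * 𝓛 ^ 5 * 𝓛 ^ 100 = 𝓛 ^ (m + 120) * (𝓛 ^ 15)⁻¹ := by
    rw [pow_add, mul_assoc, mul_assoc, show (120 : ℕ) = 105 + 15 by norm_num, pow_add, mul_assoc,
      mul_inv_cancel₀ (by positivity), mul_one, ← pow_add]
  have heq : ((A₁ * 𝓛 ^ m) * (10 * 𝓛) * (10 * 𝓛) * (3 * Cinv * 𝓛 * (17 * 𝓛 / c))) *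
      (Ed * 3 * (32 * 𝓛 / (3 * c))) * (4 * π * 𝓛 ^ 100) =
      652800 * π * A₁ * Cinv / c ^ 2 * Ed * (𝓛 ^ m * 𝓛 ^ 5 * 𝓛 ^ 100) := by
    field_simp; ring
  calc Pr * Fr * Sr ≤ _ := hmain
    _ = 652800 * π * A₁ * Cinv / c ^ 2 * Ed * (𝓛 ^ m * 𝓛 ^ 5 * 𝓛 ^ 100) := heq
    _ = 652800 * π * A₁ * Cinv / c ^ 2 * ((𝓛 ^ (m + 120) * Ed) * (𝓛 ^ 15)⁻¹) := by rw [hkey]; ring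
    _ ≤ 652800 * π * A₁ * Cinv / c ^ 2 * (Fbig * (𝓛 ^ 15)⁻¹) := by gcongr
    _ = _ := by ring

set_option maxHeartbeats 800000 in
/-- **Horizontal piece**: `2(1+η)·3M_UB_L²M_inv·max(Y^{θ−η},Y^{1+θ})e^{max/4Λ}e^{−D²/4Λ}/D ≤
10800A₁C_inv(m+18)!/2^{m+18}·𝓛⁻¹⁵`.
[cite: Zhang2022LandauSiegel, §12 p.70 (proof of Lemma 12.3)] [cite: MontgomeryVaughan2007, §6.2] -/
theorem horiz_piece_le {𝓛 c Cinv A₁ MU Y θ : ℝ} {m : ℕ} (h𝓛 : 3 ≤ 𝓛) (hc : 0 < c) (hc1 : c ≤ 1 / 4)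
    (hCinv : 0 ≤ Cinv) (hA₁ : 0 ≤ A₁) (hMU0 : 0 ≤ MU) (hMU : MU ≤ A₁ * 𝓛 ^ m)
    (hY1 : 1 ≤ Y) (hY2 : Y ≤ Real.exp (𝓛 ^ 9)) (hθ : |θ| ≤ c / (8 * 𝓛) / 4)
    (hbig : 16 * (Nat.factorial 110 : ℝ) / 2 ^ 110 ≤ 𝓛) :
    2 * ((1 - (-(c / (8 * 𝓛)))) * ((MU * (2 * (4 + 3 * 𝓛)) * (2 * (4 + 3 * 𝓛)) * (3 * Cinv * 𝓛 * 3)) *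
        (max (Y ^ (-(c / (8 * 𝓛)) + θ)) (Y ^ (1 + θ)) *
          rexp (max ((-(c / (8 * 𝓛)) + θ) ^ 2) ((1 + θ) ^ 2) / (4 * 𝓛 ^ 100)) *
          gauss (4 * 𝓛 ^ 100)⁻¹ (Real.exp 𝓛) / Real.exp 𝓛))) ≤
      10800 * A₁ * Cinv * ((m + 18).factorial / 2 ^ (m + 18)) * (𝓛 ^ 15)⁻¹ := by
  set Xr : ℝ := max (Y ^ (-(c / (8 * 𝓛)) + θ)) (Y ^ (1 + θ)) *
      rexp (max ((-(c / (8 * 𝓛)) + θ) ^ 2) ((1 + θ) ^ 2) / (4 * 𝓛 ^ 100)) *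
      gauss (4 * 𝓛 ^ 100)⁻¹ (Real.exp 𝓛) / Real.exp 𝓛 with hXr
  set Pr : ℝ := MU * (2 * (4 + 3 * 𝓛)) * (2 * (4 + 3 * 𝓛)) * (3 * Cinv * 𝓛 * 3) with hPr
  have h𝓛0 : 0 < 𝓛 := by linarith
  have h𝓛1 : 1 ≤ 𝓛 := by linarith
  set η : ℝ := c / (8 * 𝓛) with hη
  have hη0 : 0 < η := by positivity
  have hη' : η ≤ 1 / 96 := by
    calc η = c / (8 * 𝓛) := hη
      _ ≤ (1 / 4) / (8 * 3) := by gcongr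
      _ = 1 / 96 := by norm_num
  have hθb := abs_le.mp hθ
  have hY0 : 0 < Y := by linarith
  set Ep : ℝ := Real.exp (2 * 𝓛 ^ 9) with hEp
  set Em : ℝ := Real.exp (-(2 * 𝓛 ^ 9)) with hEm
  set E2 : ℝ := Real.exp (-(2 * 𝓛)) with hE2
  have hYpos : Y ^ (1 + θ) ≤ Ep := by
    calc Y ^ (1 + θ) ≤ Y ^ (2 : ℝ) := Real.rpow_le_rpow_of_exponent_le hY1 (by linarith)
      _ = Y ^ 2 := Real.rpow_two Y
      _ ≤ Real.exp (𝓛 ^ 9) ^ 2 := pow_le_pow_left₀ hY0.le hY2 2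
      _ = Ep := by rw [hEp, ← Real.exp_nat_mul]; norm_num
  have hYneg1 : Y ^ (-η + θ) ≤ 1 := Real.rpow_le_one_of_one_le_of_nonpos hY1 (by linarith)
  have h1e : (1 : ℝ) ≤ Ep := Real.one_le_exp (by positivity)
  have hYmax : max (Y ^ (-η + θ)) (Y ^ (1 + θ)) ≤ Ep := max_le (hYneg1.trans h1e) hYpos
  have hm0 : 0 ≤ max (Y ^ (-η + θ)) (Y ^ (1 + θ)) := le_max_of_le_left (Real.rpow_nonneg hY0.le _)
  have hgauss : gauss (4 * 𝓛 ^ 100)⁻¹ (Real.exp 𝓛) ≤ Em * E2 := gauss_height_le h𝓛1 hbig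
  have hg0 : 0 ≤ gauss (4 * 𝓛 ^ 100)⁻¹ (Real.exp 𝓛) := (gauss_pos _ _).le
  have he3 : Real.exp 1 ≤ 3 := by have := Real.exp_one_lt_d9; linarith
  have hE3 : rexp (max ((-η + θ) ^ 2) ((1 + θ) ^ 2) / (4 * 𝓛 ^ 100)) ≤ 3 := by
    refine le_trans (Real.exp_le_exp.mpr ?_) he3
    rw [div_le_one (by positivity)]
    have hΛ1 : (1 : ℝ) ≤ 𝓛 ^ 100 := one_le_pow₀ h𝓛1
    refine max_le ?_ ?_ <;> nlinarith
  -- `Xr ≤ Ep·3·(Em·E2)`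
  have hXrle : Xr ≤ Ep * 3 * (Em * E2) := by
    have hT1 : 1 ≤ Real.exp 𝓛 := Real.one_le_exp h𝓛0.le
    have hnum0 : 0 ≤ max (Y ^ (-η + θ)) (Y ^ (1 + θ)) *
        rexp (max ((-η + θ) ^ 2) ((1 + θ) ^ 2) / (4 * 𝓛 ^ 100)) * gauss (4 * 𝓛 ^ 100)⁻¹ (Real.exp 𝓛) :=
      mul_nonneg (mul_nonneg hm0 (Real.exp_pos _).le) hg0
    rw [hXr]
    refine (div_le_self hnum0 hT1).trans ?_
    exact mul_le_mul (mul_le_mul hYmax hE3 (Real.exp_pos _).le (Real.exp_pos _).le) hgauss hg0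
      (mul_nonneg (Real.exp_pos _).le (by norm_num))
  have hXr0 : 0 ≤ Xr := by
    rw [hXr]
    exact div_nonneg (mul_nonneg (mul_nonneg hm0 (Real.exp_pos _).le) hg0) (Real.exp_pos _).le
  -- `Pr ≤ A₁𝓛^m·10𝓛·10𝓛·9C_inv𝓛`
  have hBL : 2 * (4 + 3 * 𝓛) ≤ 10 * 𝓛 := by linarith
  have hBL0 : 0 ≤ 2 * (4 + 3 * 𝓛) := by linarith
  have hA𝓛 : 0 ≤ A₁ * 𝓛 ^ m := mul_nonneg hA₁ (pow_nonneg h𝓛0.le m)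
  have h10 : (0 : ℝ) ≤ 10 * 𝓛 := by linarith
  have h9 : 0 ≤ 3 * Cinv * 𝓛 * 3 := by
    have := mul_nonneg (mul_nonneg (by norm_num : (0 : ℝ) ≤ 3) hCinv) h𝓛0.le
    linarith [mul_nonneg this (by norm_num : (0 : ℝ) ≤ 3)]
  have hPrle : Pr ≤ (A₁ * 𝓛 ^ m) * (10 * 𝓛) * (10 * 𝓛) * (3 * Cinv * 𝓛 * 3) := by
    rw [hPr]
    exact mul_le_mul_of_nonneg_right
      (mul_le_mul (mul_le_mul hMU hBL hBL0 hA𝓛) hBL hBL0 (mul_nonneg hA𝓛 h10)) h9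
  have hP'0 : 0 ≤ (A₁ * 𝓛 ^ m) * (10 * 𝓛) * (10 * 𝓛) * (3 * Cinv * 𝓛 * 3) :=
    mul_nonneg (mul_nonneg (mul_nonneg hA𝓛 h10) h10) h9
  have h1η : 1 - (-η) ≤ 2 := by linarith
  have h1η0 : 0 ≤ 1 - (-η) := by linarith
  have hPX : Pr * Xr ≤ ((A₁ * 𝓛 ^ m) * (10 * 𝓛) * (10 * 𝓛) * (3 * Cinv * 𝓛 * 3)) * (Ep * 3 * (Em * E2)) :=
    mul_le_mul hPrle hXrle hXr0 hP'0
  have hPX0 : 0 ≤ Pr * Xr := mul_nonneg (by rw [hPr]; exact mul_nonneg (mul_nonneg (mul_nonneg hMU0 hBL0) hBL0) h9) hXr0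
  have hmain : 2 * ((1 - (-η)) * (Pr * Xr)) ≤
      2 * (2 * (((A₁ * 𝓛 ^ m) * (10 * 𝓛) * (10 * 𝓛) * (3 * Cinv * 𝓛 * 3)) * (Ep * 3 * (Em * E2)))) :=
    mul_le_mul_of_nonneg_left (mul_le_mul h1η hPX hPX0 (by norm_num)) (by norm_num)
  have hdec : 𝓛 ^ (m + 18) * E2 ≤ ((m + 18).factorial : ℝ) / 2 ^ (m + 18) := by
    rw [hE2]; exact pow_mul_exp_neg_le (a := 2) (by norm_num) h𝓛0.le (m + 18)
  have hkey : 𝓛 ^ m * 𝓛 ^ 3 = 𝓛 ^ (m + 18) * (𝓛 ^ 15)⁻¹ := by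
    rw [pow_add, mul_assoc, show (18 : ℕ) = 3 + 15 by norm_num, pow_add, mul_assoc,
      mul_inv_cancel₀ (by positivity), mul_one]
  have hEE : Ep * Em = 1 := by
    rw [hEp, hEm, ← Real.exp_add, add_neg_cancel, Real.exp_zero]
  calc 2 * ((1 - (-η)) * (Pr * Xr)) ≤ _ := hmain
    _ = 10800 * A₁ * Cinv * (Ep * Em) * E2 * (𝓛 ^ m * 𝓛 ^ 3) := by ring
    _ = 10800 * A₁ * Cinv * ((𝓛 ^ (m + 18) * E2) * (𝓛 ^ 15)⁻¹) := by rw [hEE, hkey]; ring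
    _ ≤ 10800 * A₁ * Cinv * ((((m + 18).factorial : ℝ) / 2 ^ (m + 18)) * (𝓛 ^ 15)⁻¹) := by gcongr
    _ = _ := by ring

/-- **The Landau-rectangle remainder is `O(𝓛⁻¹⁵)`** (sum of the three pieces, times `1/2π`).
[cite: Zhang2022LandauSiegel, §12 p.70 (proof of Lemma 12.3)] [cite: MontgomeryVaughan2007, §6.2] -/
theorem remainder_le {𝓛 c Cinv A₁ MU Y θ : ℝ} {m : ℕ} (h𝓛 : 3 ≤ 𝓛) (hc : 0 < c) (hc1 : c ≤ 1 / 4)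
    (hCinv : 0 ≤ Cinv) (hA₁ : 0 ≤ A₁) (hMU0 : 0 ≤ MU) (hMU : MU ≤ A₁ * 𝓛 ^ m)
    (hY1 : Real.exp (𝓛 ^ (1.1 : ℝ)) ≤ Y) (hY2 : Y ≤ Real.exp (𝓛 ^ 9))
    (hθ : |θ| ≤ c / (8 * 𝓛) / 4) (hbig : 16 * (Nat.factorial 110 : ℝ) / 2 ^ 110 ≤ 𝓛) :
    1 / (2 * π) *
        (2 * ((MU * ((1 + 1 / 2) / (1 / 2)) ^ 3) *
              (Y ^ (1 + θ) * rexp ((1 + θ) ^ 2 / (4 * 𝓛 ^ 100)) / |1 + θ|) *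
            (gauss (4 * 𝓛 ^ 100)⁻¹ (Real.exp 𝓛) * (Real.sqrt (4 * π * 𝓛 ^ 100) / 2))) +
          (MU * (2 * (4 + 3 * 𝓛)) * (2 * (4 + 3 * 𝓛)) * (3 * Cinv * 𝓛 * (1 + 2 / (c / (8 * 𝓛))))) *
              (Y ^ (-(c / (8 * 𝓛)) + θ) * rexp ((-(c / (8 * 𝓛)) + θ) ^ 2 / (4 * 𝓛 ^ 100)) /
                |(-(c / (8 * 𝓛))) + θ|) * Real.sqrt (4 * π * 𝓛 ^ 100) +
          2 * ((1 - (-(c / (8 * 𝓛)))) * ((MU * (2 * (4 + 3 * 𝓛)) * (2 * (4 + 3 * 𝓛)) * (3 * Cinv * 𝓛 * 3)) *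
              (max (Y ^ (-(c / (8 * 𝓛)) + θ)) (Y ^ (1 + θ)) *
                rexp (max ((-(c / (8 * 𝓛)) + θ) ^ 2) ((1 + θ) ^ 2) / (4 * 𝓛 ^ 100)) *
                gauss (4 * 𝓛 ^ 100)⁻¹ (Real.exp 𝓛) / Real.exp 𝓛)))) ≤
      1 / (2 * π) * (648 * π * A₁ * ((m + 115).factorial / 2 ^ (m + 115)) +
          652800 * π * A₁ * Cinv / c ^ 2 * ((10 * (m + 120)).factorial / (3 * c / 32) ^ (10 * (m + 120))) +
          10800 * A₁ * Cinv * ((m + 18).factorial / 2 ^ (m + 18))) * (𝓛 ^ 15)⁻¹ := by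
  have h𝓛0 : 0 < 𝓛 := by linarith
  have hY1' : 1 ≤ Y := le_trans (Real.one_le_exp (Real.rpow_nonneg h𝓛0.le _)) hY1
  have hθ' : |θ| ≤ 1 / 2 := by
    refine hθ.trans ?_
    rw [div_div, div_le_iff₀ (by positivity)]; nlinarith
  have t1 := tails_piece_le (m := m) h𝓛 hA₁ hMU hY1' hY2 hθ' hbig
  have t2 := left_piece_le (m := m) h𝓛 hc hc1 hCinv hA₁ hMU hY1 hθ
  have t3 := horiz_piece_le (m := m) h𝓛 hc hc1 hCinv hA₁ hMU0 hMU hY1' hY2 hθ hbig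
  set Fbig : ℝ := ((10 * (m + 120)).factorial : ℝ) / (3 * c / 32) ^ (10 * (m + 120)) with hFbig
  clear_value Fbig
  have hsum := add_le_add (add_le_add t1 t2) t3
  calc _ ≤ 1 / (2 * π) * (648 * π * A₁ * ((m + 115).factorial / 2 ^ (m + 115)) * (𝓛 ^ 15)⁻¹ +
        652800 * π * A₁ * Cinv / c ^ 2 * Fbig * (𝓛 ^ 15)⁻¹ +
        10800 * A₁ * Cinv * ((m + 18).factorial / 2 ^ (m + 18)) * (𝓛 ^ 15)⁻¹) :=
      mul_le_mul_of_nonneg_left hsum (by positivity)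
    _ = _ := by ring

end Literature.NumberTheory.LFunctions.Zhang2022.Lemma84
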